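import Mathlib
import Summits.Ventures.PercRepro2.LocRows
import Summits.Ventures.PercRepro2.SwRow
import Summits.Ventures.PercRepro2.SwOut
import Summits.Ventures.PercRepro2.SwAllRow
import Summits.Ventures.PercRepro2.SwOutAll
import Summits.Ventures.PercRepro2.SwOutArmFlip
import Summits.Ventures.PercRepro2.SwOutArmThm
import Summits.Ventures.PercRepro2.SwOutCoreDefs
import Summits.Ventures.PercRepro2.SwOutBigBlockDefs
import Summits.Ventures.PercRepro2.SwOutMixedBaseDefs
import Summits.Ventures.PercRepro2.SwOutMixedBaseClasses
import Summits.Ventures.PercRepro2.SwOutMixedBaseHull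
import Summits.Ventures.PercRepro2.SwOutMixedBaseDual
import Summits.Ventures.PercRepro2.SwOutMixedBaseArm
import Summits.Ventures.PercRepro2.SwOutMixedBaseArm2
import Summits.Ventures.PercRepro2.SwOutMixedCore
import Summits.Ventures.PercRepro2.SwOutMixedCoreEdgeMap

/-!
# The arm moves of the mixed single junction at every non-leaking point with unmixed u-arms
(blind cell PercRepro2, night-4 g18, 2026-08-27; proofs/NIGHT4-G18.md §5, item (G3) of
NIGHT4-G17.md §4⁗′)

Vocabulary: the mixed base and its realisation (`SwOutMixedBaseDefs`), the hull formulas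
`cluster_mixedReal` / `cluster_blue_mixedReal` at points without red- / blue-side leak
(`SwOutMixedBaseHull` / `Dual`), the moves `toggleF k` / `toggleAh` and the flip identities
`flip_F` / `flip_Ah` (`SwOutMixedBaseArm2`), the generic arm principle
`flip_mem_tgtU_of_armClosed_red` (`SwOutArmFlip`: a red arm, closed in the hull, flipped to blue
keeps the conditioning when the two clusters of `h` meet only in `h`), and the membership lemmas
of `redSetM` (`SwOutMixedCoreEdgeMap`).

At a non-leaking point the red and blue clusters of `h` are `redSetM q` and `redSetM (flipPt q)`;
they meet only in `h` exactly when the u-arms are NOT mixed (`u` lies in both hulls iff some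
u-arm is red and some blue): `coreFree_of_unmixed`.  A far arm is closed in the hull at every
non-leaking point (`armClosed_F'`), the h-piece when `p` is not in the hull (`armClosed_Ah'`: its
dead edges to `p`).  Hence the generic arm principle gives the (G3) moves at EVERY non-leaking
point with unmixed u-arms: `mem_tgtU_toggleF'` (a red far arm to blue) and `mem_tgtU_toggleAh'`
(the red h-piece to blue, `p ∉ hull`) — generalising `mem_tgtU_toggleF` / `mem_tgtU_toggleAh`
(p491513, dropped points with every u-arm red) to the whole `s = ⊤` and `s = ⊥` layers of the
block (in particular `D(0,1,f) → D(0,0,f)` and `F(⊥,1,f) → x̄(f)`).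
-/

namespace Summit.Ventures.PercRepro2

namespace BigBlock

open Hull LocRows

variable {V : Type*} {E : Type*}

section Unmixed

variable {ι κ : Type*}

/-- The u-arms of a point are unmixed: all red or all blue. -/
def Unmixed (q : Pt ι κ) : Prop := (∀ j, q.1 j = true) ∨ (∀ j, q.1 j = false)

/-- At an unmixed point, `u` is not in both predicted clusters. -/
lemma Unmixed.not_both {q : Pt ι κ} (hq : Unmixed q) (h1 : ∃ j, q.1 j = true)
    (h2 : ∃ j, q.1 j = false) : False := by
  obtain ⟨j1, hj1⟩ := h1
  obtain ⟨j2, hj2⟩ := h2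
  rcases hq with hq | hq
  · rw [hq j2] at hj2; exact absurd hj2 (by decide)
  · rw [hq j1] at hj1; exact absurd hj1 (by decide)

end Unmixed

section Moves

variable {ends : E → Sym2 V} {σ : Config E} {h u p : V} {ι κ : Type*} {U : ι → Set V} {Ah : Set V}
  {F : κ → Set V} (hb : MixedBase ends σ h u p U Ah F)
include hb

/-- **The two clusters of `h` meet only in `h`** at a non-leaking point with unmixed u-arms. -/
theorem MixedBase.coreFree_of_unmixed (hup : ∃ e, ends e = s(u, p)) {q : Pt ι κ}
    (hqR : ¬ LeakR q) (hqB : ¬ LeakB q) (hs : Unmixed q) :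
    CoreFree ends (mixedReal ends u p U Ah F σ q) h := by
  intro x hxT hxB
  rw [hb.cluster_mixedReal hup hqR, mem_redSetM_iff] at hxT
  rw [hb.cluster_blue_mixedReal hup hqB, mem_redSetM_iff] at hxB
  simp only [flipPt, flipAll, Bool.not_eq_true'] at hxB
  rcases hxT with rfl | ⟨j, hj, hx⟩ | ⟨rfl, hs1⟩ | ⟨rfl, hs1, huP⟩ | ⟨ha, hx⟩ | ⟨k, hk, hx⟩
  · rfl
  · rcases hxB with rfl | ⟨j', hj', hx'⟩ | ⟨rfl, _⟩ | ⟨rfl, _⟩ | ⟨_, hx'⟩ | ⟨k', _, hx'⟩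
    · rfl
    · by_cases hjj : j = j'
      · subst hjj; rw [hj] at hj'; exact absurd hj' (by decide)
      · exact absurd hx' (hb.U_disj j j' hjj x hx)
    · exact absurd hx (hb.u_notMem_U j)
    · exact absurd hx (hb.p_notMem_U j)
    · exact absurd hx' (hb.U_disj_Ah j x hx)
    · exact absurd hx' (hb.U_disj_F j k' x hx)
  · rcases hxB with hxh | ⟨j', _, hx'⟩ | ⟨_, hs2⟩ | ⟨hup', _⟩ | ⟨_, hx'⟩ | ⟨k', _, hx'⟩
    · exact hxh
    · exact absurd hx' (hb.u_notMem_U j')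
    · exact (hs.not_both hs1 hs2).elim
    · exact absurd hup' hb.hne_up
    · exact absurd hx' hb.u_notMem_Ah
    · exact absurd hx' (hb.u_notMem_F k')
  · rcases hxB with hxh | ⟨j', _, hx'⟩ | ⟨hpu, _⟩ | ⟨_, _, huP'⟩ | ⟨_, hx'⟩ | ⟨k', _, hx'⟩
    · exact hxh
    · exact absurd hx' (hb.p_notMem_U j')
    · exact absurd hpu.symm hb.hne_up
    · rw [huP] at huP'; exact absurd huP' (by decide)
    · exact absurd hx' hb.p_notMem_Ah
    · exact absurd hx' (hb.p_notMem_F k')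
  · rcases hxB with rfl | ⟨j', _, hx'⟩ | ⟨rfl, _⟩ | ⟨rfl, _⟩ | ⟨ha', _⟩ | ⟨k', _, hx'⟩
    · rfl
    · exact absurd hx (hb.U_disj_Ah j' x hx')
    · exact absurd hx hb.u_notMem_Ah
    · exact absurd hx hb.p_notMem_Ah
    · rw [ha] at ha'; exact absurd ha' (by decide)
    · exact absurd hx' (hb.Ah_disj_F k' x hx)
  · rcases hxB with rfl | ⟨j', _, hx'⟩ | ⟨rfl, _⟩ | ⟨rfl, _⟩ | ⟨_, hx'⟩ | ⟨k', hk', hx'⟩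
    · rfl
    · exact absurd hx (hb.U_disj_F j' k x hx')
    · exact absurd hx (hb.u_notMem_F k)
    · exact absurd hx (hb.p_notMem_F k)
    · exact absurd hx (hb.Ah_disj_F k x hx')
    · by_cases hkk : k = k'
      · subst hkk; rw [hk] at hk'; exact absurd hk' (by decide)
      · exact absurd hx' (hb.F_disj k k' hkk x hx)

/-- A vertex outside `{h, u, p}` and the arms is not in the hull at a non-leaking point. -/
lemma MixedBase.not_mem_hull_of_out' (hup : ∃ e, ends e = s(u, p)) {q : Pt ι κ}
    (hqR : ¬ LeakR q) (hqB : ¬ LeakB q) {y : V} (hyh : y ≠ h) (hyu : y ≠ u) (hyp : y ≠ p)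
    (hout : y ∉ armsAll U Ah F) :
    y ∉ hull ends (mixedReal ends u p U Ah F σ q) h := by
  intro hy
  rcases hb.hull_mixedReal_subset hup hqR hqB hy with ((hy' | hy') | hy') | hy'
  · exact hyh hy'
  · exact hyu hy'
  · exact hyp hy'
  · exact hout hy'

/-- **A red far arm is closed in the hull** at every non-leaking point. -/
theorem MixedBase.armClosed_F' (hup : ∃ e, ends e = s(u, p)) {q : Pt ι κ}
    (hqR : ¬ LeakR q) (hqB : ¬ LeakB q) {k : κ} (hk : q.2.2.2.2 k = true) :
    ArmClosed ends (mixedReal ends u p U Ah F σ q) h (F k) where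
  subset := by
    intro x hx
    refine ⟨Or.inl ?_, fun hxh => hb.h_notMem_F k (hxh ▸ hx)⟩
    rw [hb.cluster_mixedReal hup hqR]
    exact (hb.mem_redSetM_F hx).2 hk
  closed := by
    intro e x y hxy hx hy hyh
    obtain ⟨x', y', hxy', hx', hy'⟩ := hb.ends_of_touches_F ⟨x, hx, y, hxy⟩
    rw [hxy, Sym2.eq_iff] at hxy'
    rcases hxy' with ⟨_, rfl⟩ | ⟨rfl, rfl⟩
    · rcases hy' with hy' | hy' | ⟨hyh', _, hyp', hout⟩
      · exact hy'
      · exact absurd hy' hyh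
      · exact absurd hy (hb.not_mem_hull_of_out' hup hqR hqB hyh' (by
          rintro rfl
          exact hb.no_uF (ends_swap hxy) k hx) hyp' hout)
    · exact hx'

/-- **The red h-piece is closed in the hull** at a non-leaking point where `p` is not in the
hull (its dead edges to `p` are the only edges leaving it inside the region). -/
theorem MixedBase.armClosed_Ah' (hup : ∃ e, ends e = s(u, p)) {q : Pt ι κ}
    (hqR : ¬ LeakR q) (hqB : ¬ LeakB q) (ha : q.2.1 = true)
    (hp : p ∉ hull ends (mixedReal ends u p U Ah F σ q) h) :
    ArmClosed ends (mixedReal ends u p U Ah F σ q) h Ah where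
  subset := by
    intro x hx
    refine ⟨Or.inl ?_, fun hxh => hb.h_notMem_Ah (hxh ▸ hx)⟩
    rw [hb.cluster_mixedReal hup hqR]
    exact (hb.mem_redSetM_Ah hx).2 ha
  closed := by
    intro e x y hxy hx hy hyh
    obtain ⟨x', y', hxy', hx', hy'⟩ := hb.ends_of_touches_Ah ⟨x, hx, y, hxy⟩
    rw [hxy, Sym2.eq_iff] at hxy'
    rcases hxy' with ⟨_, rfl⟩ | ⟨rfl, rfl⟩
    · rcases hy' with hy' | hy' | hy' | ⟨hyh', hyu', hyp', hout⟩
      · exact hy'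
      · exact absurd hy' hyh
      · exact absurd hy (hy' ▸ hp)
      · exact absurd hy (hb.not_mem_hull_of_out' hup hqR hqB hyh' hyu' hyp' hout)
    · exact hx'

/-- `p` is not in the hull at a non-leaking point iff it is not predicted in either cluster. -/
lemma MixedBase.p_not_mem_hull' (hup : ∃ e, ends e = s(u, p)) {q : Pt ι κ}
    (hqR : ¬ LeakR q) (hqB : ¬ LeakB q)
    (hR : ¬ ((∃ j, q.1 j = true) ∧ q.2.2.1 = true))
    (hB : ¬ ((∃ j, q.1 j = false) ∧ q.2.2.1 = false)) :
    p ∉ hull ends (mixedReal ends u p U Ah F σ q) h := by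
  rintro (hy | hy)
  · rw [hb.cluster_mixedReal hup hqR] at hy
    exact hR (hb.mem_redSetM_p.1 hy)
  · rw [hb.cluster_blue_mixedReal hup hqB] at hy
    have := hb.dual.mem_redSetM_p.1 hy
    simp only [flipPt, flipAll, Bool.not_eq_true'] at this
    exact hB this

/-- **The far-arm move keeps the conditioning at every non-leaking point with unmixed u-arms.** -/
theorem MixedBase.mem_tgtU_toggleF' [Fintype E] [DecidableEq E]
    (hup : ∃ e, ends e = s(u, p)) {Us : Set V} {l o : V} (hl : l ∉ Us) {q : Pt ι κ}
    (hqR : ¬ LeakR q) (hqB : ¬ LeakB q) (hs : Unmixed q) {k : κ} (hk : q.2.2.2.2 k = true)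
    (hFU : F k ⊆ Us) (hQ : mixedReal ends u p U Ah F σ q ∈ tgtU ends l h {S : Set V | o ∈ S}) :
    mixedReal ends u p U Ah F σ (toggleF k q) ∈ tgtU ends l h {S : Set V | o ∈ S} := by
  rw [← hb.flip_F]
  refine flip_mem_tgtU_of_armClosed_red (hb.coreFree_of_unmixed hup hqR hqB hs)
    (hb.armClosed_F' hup hqR hqB hk) ?_ hFU hl hQ
  intro x hx
  rw [hb.cluster_mixedReal hup hqR]
  exact (hb.mem_redSetM_F hx).2 hk

/-- **The h-piece move keeps the conditioning at every non-leaking point with unmixed u-arms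
where `p` is not in the hull.** -/
theorem MixedBase.mem_tgtU_toggleAh' [Fintype E] [DecidableEq E]
    (hup : ∃ e, ends e = s(u, p)) {Us : Set V} {l o : V} (hl : l ∉ Us) {q : Pt ι κ}
    (hqR : ¬ LeakR q) (hqB : ¬ LeakB q) (hs : Unmixed q) (ha : q.2.1 = true)
    (hp : p ∉ hull ends (mixedReal ends u p U Ah F σ q) h) (hAU : Ah ⊆ Us)
    (hQ : mixedReal ends u p U Ah F σ q ∈ tgtU ends l h {S : Set V | o ∈ S}) :
    mixedReal ends u p U Ah F σ (toggleAh q) ∈ tgtU ends l h {S : Set V | o ∈ S} := by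
  rw [← hb.flip_Ah]
  refine flip_mem_tgtU_of_armClosed_red (hb.coreFree_of_unmixed hup hqR hqB hs)
    (hb.armClosed_Ah' hup hqR hqB ha hp) ?_ hAU hl hQ
  intro x hx
  rw [hb.cluster_mixedReal hup hqR]
  exact (hb.mem_redSetM_Ah hx).2 ha

end Moves

end BigBlock

end Summit.Ventures.PercRepro2
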